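import Summits.QuantumFields.YangMills.Theorems.BalabanUVNodesN15KingModelAnalyticBlockCovAccretive
import Mathlib.LinearAlgebra.Matrix.Charpoly.Eigs
import HarnessLib

/-!
# BalabanUVNodes ∕ N15 — THE KING-MODEL RUNG (PART Ϫ-g, `𝕜 = ℂ`): THE BLOCK-FIELD GAUSSIAN NORMALISATION `det Δ_eff(U,U⁻¹)` CONTINUES ANALYTICALLY IN THE BACKGROUND, NEVER VANISHES,
# AND ITS LOGARITHM PER DEGREE OF FREEDOM IS BOUNDED UNIFORMLY — in PART Ϫ-f's accretivity window around every unitary background (any curvature) every eigenvalue `μ` of King's continued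
# effective Laplacian satisfies `β₁ ≤ |μ| ≤ Γ₁` with `β₁ = (a⁻¹∕2)∕(a⁻¹ + 4e∕m²)²`, `Γ₁ = (a + a²(8∕m²)e³)·K_{d+1}(ctRate(m²∕2,a,d))`, so ★★★★ `β₁^N ≤ |det Δ_eff(U,U⁻¹)| ≤ Γ₁^N`
# (`N = |T_M|·n` block degrees of freedom) and `|log|det Δ_eff(U,U⁻¹)|| ≤ N·max(|log β₁|, |log Γ₁|)`: the free energy density of the block-field Gaussian is `O(1)` uniformly in the volume,
# the spacing and the fibre throughout the complex window
# (Track A, DAG node N15 = NE2; FAN-OUT v1.1 §N15 s3 «KING-MODEL RUNG … + what the curved case adds»; count-neutral)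

HONEST FRAMING.  Count-neutral (cell `pub-ymgap`, seat `pub-ymgap-dag-n15-e` g52; `--supports stmt-QuantumFields-27247 --as helper` = K3ᴬ, KEY MAP v3).  King's one-level comparison model,
massive fine covariance, fibre `ℂⁿ`, King's scaling, comb-depth contours; determinant bounds through the spectrum (`det = ∏` roots of the characteristic polynomial over `ℂ`), no Gaussian
integral is evaluated here (the normalisation `(2π)^{N∕2}(det Δ_eff)^{−1∕2}` of `exp(−½⟨ψ,Δ_eff ψ⟩)` is the tree's `N15KingModelRung` Gaussian-law files at `A = 0`); constants crude
(`K_{d+1}`, `8e³`).  NOT Bałaban's multi-level objects; NOT a node discharge (N15 of record untouched); nothing continuum ∕ ℝ⁴ ∕ OS ∕ Clay.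

THE RESULTS:
* §1 SPECTRAL TOOLS (any finite index type `ι`, `A : Matrix ι ι ℂ`): `exists_eigenvector_of_isRoot_charpoly`, `pow_card_le_prod_norm`, `prod_norm_le_pow_card`, ★★ `pow_card_le_norm_det_of_eigen`
  (`∀` eigenpairs `β ≤ |μ|`, `0 ≤ β` ⟹ `β^{|ι|} ≤ |det A|`), ★★ `norm_det_le_pow_card_of_eigen` (`|μ| ≤ Γ` ⟹ `|det A| ≤ Γ^{|ι|}`), `norm_det_le_l2_opNorm_pow` (`|det A| ≤ ‖A‖^{|ι|}`).
* §2 IN THE WINDOW (`2Lε ≤ s₀(m²,a,d)`, `covLip·Lε∕s₀(m²,0,d) ≤ a⁻¹∕2`, unitary `U₀`, complex `U` within `ε`): ★★★ `l2_opNorm_cxEffLap_at_massRadius_le` (`‖Δ_eff(U,U⁻¹)‖ ≤ (a + a²(8∕m²)e³)K_{d+1}(ctRate(m²∕2,a,d))`, `Lε ≤ s₀(m²,a,d)`),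
  ★★★★ **`pow_le_norm_det_cxEffLap`** (`β₁^N ≤ |det Δ_eff(U,U⁻¹)|`), ★★★ **`norm_det_cxEffLap_le_pow`** (`≤ Γ₁^N`), ★★★ `det_cxEffLap_ne_zero`, ★★★★ **`abs_log_norm_det_cxEffLap_le`**
  (`|log|det Δ_eff(U,U⁻¹)|| ≤ N·max(|log β₁|,|log Γ₁|)` — the free energy per degree of freedom is bounded uniformly), ★★★ `analyticOnNhd_det_printEffLap_polydisc` (`U ↦ det Δ_eff(U,U⁻¹)` analytic on
  the polydisc `s₀(m²,a,d)∕L` — a finite sum of finite products of analytic entries).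
PRIOR TREE ART (by name): Ϫ-f (`covLip`, `norm_eigenvalue_cxEffLap_ge`, `norm_eigenvalue_le_l2_opNorm`, `l2_opNorm_le_of_blk_decay`, `windows_of_h2a`), Ϫ-d (`analyticOnNhd_printEffLap_polydisc`), Ϫ-b (`mass_coercive_fullOpU`),
Ϩ-l (`norm_blk_cxEffLap_at_radius_le`), Ϛ-h (`cxEntryCLM`), Mathlib (`Matrix.det_eq_prod_roots_charpoly`, `Matrix.eval_charpoly`, `Matrix.exists_mulVec_eq_zero_iff`, `Polynomial.splits_iff_card_roots`, `Matrix.charpoly_natDegree_eq_dim`,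
`Matrix.det_apply'`, `Finset.analyticAt_fun_prod`).  Dedup (rg at filing): basename 0 files; needles `norm_det_cxEffLap|pow_card_le_norm_det_of_eigen|exists_eigenvector_of_isRoot_charpoly|abs_log_norm_det` 0 tree files; preflight `dedup.landed` caught a `‖∏‖ = ∏‖·‖` one-liner ≡ `RoyWaldschmidt1997.norm_multiset_prod` — inlined via `map_multiset_prod normHom`.
Locators: [King1986] (2.14) p.653, (4.5) p.670, (4.45) p.675; [Balaban1985BackgroundPropagators] Thm 3.4 p.400.  0 `sorry`, 0 `def`.
-/

noncomputable section
open scoped BigOperators ComplexConjugate ComplexOrder Matrix.Norms.L2Operator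
open Finset Matrix WithLp Polynomial

namespace Summit.QuantumFields.YangMills.BalabanUVNodes.N15KingModelRung.Analytic

open Literature.MathematicalPhysics.QuantumFieldTheory.LatticeDiamagneticInequality (blk)
open Literature.MathematicalPhysics.QuantumFieldTheory.Balaban1983to89 (B4Sect5Proof.latticeConst B4Sect5Proof.latticeConst_nonneg)
open Literature.MathematicalPhysics.QuantumFieldTheory.Balaban1983to89.B5Prop11Plancherel (Tor fine)
open Summit.QuantumFields.YangMills.BalabanUVNodes.N15KingModelRung.Covariant (cxEntryCLM fib)
open Summit.QuantumFields.YangMills.BalabanUVNodes.N15KingModelRung.CovariantBlock (BlockTree fullOpU)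
open Summit.QuantumFields.YangMills.BalabanUVNodes.N15KingModelRung.CombesThomas (ctRate ctRate_pos ctRate_nonneg)

/-! ## §1 Spectral tools: determinants through eigenvalue bounds -/

section Spectral

variable {ι : Type*} [Fintype ι] [DecidableEq ι]

/-- A ROOT OF THE CHARACTERISTIC POLYNOMIAL HAS AN EIGENVECTOR: `χ_A(μ) = 0` ⟹ `∃ v ≠ 0, Av = μv`. [folklore] -/
theorem exists_eigenvector_of_isRoot_charpoly {A : Matrix ι ι ℂ} {μ : ℂ} (h : IsRoot A.charpoly μ) : ∃ v : ι → ℂ, v ≠ 0 ∧ A *ᵥ v = μ • v := by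
  have hdet : (Matrix.scalar ι μ - A).det = 0 := by rw [← Matrix.eval_charpoly]; exact h
  obtain ⟨v, hv, hv0⟩ := Matrix.exists_mulVec_eq_zero_iff.mpr hdet
  refine ⟨v, hv, ?_⟩
  rw [Matrix.sub_mulVec, sub_eq_zero, Matrix.scalar_apply] at hv0
  rw [← hv0]
  funext x
  rw [Matrix.mulVec_diagonal, Pi.smul_apply, smul_eq_mul]

omit [Fintype ι] [DecidableEq ι] in
/-- `β ≤ ‖z‖` on a multiset (`0 ≤ β`) ⟹ `β^{card} ≤ ∏ ‖z‖`. [folklore] -/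
theorem pow_card_le_prod_norm {s : Multiset ℂ} {β : ℝ} (hβ : 0 ≤ β) (h : ∀ z ∈ s, β ≤ ‖z‖) : β ^ Multiset.card s ≤ (s.map fun z => ‖z‖).prod := by
  induction s using Multiset.induction_on with
  | empty => simp
  | cons a s ih =>
      rw [Multiset.card_cons, Multiset.map_cons, Multiset.prod_cons, pow_succ, mul_comm]
      have ha : β ≤ ‖a‖ := h a (Multiset.mem_cons_self a s)
      have hs : β ^ Multiset.card s ≤ (s.map fun z => ‖z‖).prod := ih fun z hz => h z (Multiset.mem_cons_of_mem hz)
      exact mul_le_mul ha hs (pow_nonneg hβ _) (norm_nonneg _)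

omit [Fintype ι] [DecidableEq ι] in
/-- `‖z‖ ≤ Γ` on a multiset ⟹ `∏ ‖z‖ ≤ Γ^{card}`. [folklore] -/
theorem prod_norm_le_pow_card {s : Multiset ℂ} {Γ : ℝ} (h : ∀ z ∈ s, ‖z‖ ≤ Γ) : (s.map fun z => ‖z‖).prod ≤ Γ ^ Multiset.card s := by
  induction s using Multiset.induction_on with
  | empty => simp
  | cons a s ih =>
      rw [Multiset.card_cons, Multiset.map_cons, Multiset.prod_cons, pow_succ, mul_comm]
      have ha : ‖a‖ ≤ Γ := h a (Multiset.mem_cons_self a s)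
      have hs : (s.map fun z => ‖z‖).prod ≤ Γ ^ Multiset.card s := ih fun z hz => h z (Multiset.mem_cons_of_mem hz)
      exact mul_le_mul hs ha (norm_nonneg a) (pow_nonneg ((norm_nonneg a).trans ha) _)

/-- The roots of the characteristic polynomial: `card = |ι|` and each root is an eigenvalue. [folklore] -/
theorem card_roots_charpoly (A : Matrix ι ι ℂ) : Multiset.card A.charpoly.roots = Fintype.card ι := by
  rw [Polynomial.splits_iff_card_roots.mp (IsAlgClosed.splits A.charpoly), Matrix.charpoly_natDegree_eq_dim]

/-- ★★ **A UNIFORM LOWER BOUND ON THE EIGENVALUES BOUNDS THE DETERMINANT BELOW**: `β ≤ |μ|` for every eigenpair (`0 ≤ β`) ⟹ `β^{|ι|} ≤ |det A|`. [folklore] -/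
theorem pow_card_le_norm_det_of_eigen {A : Matrix ι ι ℂ} {β : ℝ} (hβ : 0 ≤ β) (h : ∀ (μ : ℂ) (v : ι → ℂ), v ≠ 0 → A *ᵥ v = μ • v → β ≤ ‖μ‖) : β ^ Fintype.card ι ≤ ‖A.det‖ := by
  have hn : ‖A.charpoly.roots.prod‖ = (A.charpoly.roots.map fun z => ‖z‖).prod := by simpa using map_multiset_prod (normHom : ℂ →*₀ ℝ) A.charpoly.roots
  rw [Matrix.det_eq_prod_roots_charpoly, hn, ← card_roots_charpoly A]
  refine pow_card_le_prod_norm hβ fun z hz => ?_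
  obtain ⟨v, hv, hAv⟩ := exists_eigenvector_of_isRoot_charpoly ((Polynomial.mem_roots (Matrix.charpoly_monic A).ne_zero).mp hz)
  exact h z v hv hAv

/-- ★★ **A UNIFORM UPPER BOUND ON THE EIGENVALUES BOUNDS THE DETERMINANT ABOVE**: `|μ| ≤ Γ` for every eigenpair ⟹ `|det A| ≤ Γ^{|ι|}`. [folklore] -/
theorem norm_det_le_pow_card_of_eigen {A : Matrix ι ι ℂ} {Γ : ℝ} (h : ∀ (μ : ℂ) (v : ι → ℂ), v ≠ 0 → A *ᵥ v = μ • v → ‖μ‖ ≤ Γ) : ‖A.det‖ ≤ Γ ^ Fintype.card ι := by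
  have hn : ‖A.charpoly.roots.prod‖ = (A.charpoly.roots.map fun z => ‖z‖).prod := by simpa using map_multiset_prod (normHom : ℂ →*₀ ℝ) A.charpoly.roots
  rw [Matrix.det_eq_prod_roots_charpoly, hn, ← card_roots_charpoly A]
  refine prod_norm_le_pow_card fun z hz => ?_
  obtain ⟨v, hv, hAv⟩ := exists_eigenvector_of_isRoot_charpoly ((Polynomial.mem_roots (Matrix.charpoly_monic A).ne_zero).mp hz)
  exact h z v hv hAv

end Spectral

variable {d : ℕ} {L : ℕ} [NeZero L] (T : BlockTree d L) (M : Fin (d + 1) → ℕ) [hM : ∀ μ, NeZero (M μ)]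
variable {n : Type*} [Fintype n] [DecidableEq n]

omit [NeZero L] in
/-- HADAMARD-TYPE BOUND THROUGH THE SPECTRUM: `|det A| ≤ ‖A‖^{|T_M|·n}` for block-lattice operators. [folklore] -/
theorem norm_det_le_l2_opNorm_pow (A : Matrix (Tor M × n) (Tor M × n) ℂ) : ‖A.det‖ ≤ ‖A‖ ^ Fintype.card (Tor M × n) :=
  norm_det_le_pow_card_of_eigen fun _ _ hv hAv => norm_eigenvalue_le_l2_opNorm M hv hAv

/-! ## §2 The Gaussian normalisation of the block field in the complex window -/

section Window

variable (hD : ∀ j, T.depth j ≤ (d + 1) * (L - 1)) {a m2 : ℝ} (ha : 0 < a) (hm : 0 < m2) (hL : 1 ≤ L)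
variable {U₀ U : Tor (fine L M) × Fin (d + 1) → Matrix n n ℂ} (hU₀ : ∀ bd, U₀ bd ∈ Matrix.unitaryGroup n ℂ)
include hD ha hm hL hU₀

/-- ★★★ **THE CONTINUED EFFECTIVE LAPLACIAN IS BOUNDED IN OPERATOR NORM**: `‖U_b − U₀_b‖ ≤ ε`, `Lε ≤ s₀(m²,a,d)` ⟹ `‖Δ_eff(U,U⁻¹)‖ ≤ (a + a²(8∕m²)e³)·K_{d+1}(ctRate(m²∕2,a,d))`
(PART Ϩ-l's King (4.34)(ii) at the mass floor, summed by the block Schur test). [cite: King1986, (2.14) p.653, (4.34) p.674; Balaban1985BackgroundPropagators, Thm 3.4 p.400] -/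
theorem l2_opNorm_cxEffLap_at_massRadius_le {ε : ℝ} (hε0 : 0 ≤ ε) (hU : ∀ bd, ‖U bd - U₀ bd‖ ≤ ε) (hrad : (L : ℝ) * ε ≤ sliceRadius m2 a d) :
    ‖cxEffLap T M a ((L : ℝ) ^ 2) m2 U (fun bd => (U bd)⁻¹)‖ ≤ (a + a ^ 2 * (8 / m2 * Real.exp 3)) * B4Sect5Proof.latticeConst (d + 1) (ctRate (m2 / 2) a d) :=
  l2_opNorm_le_of_blk_decay M (by positivity) (ctRate_pos (by positivity : 0 < m2 / 2) ha.le d)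
    (norm_blk_cxEffLap_at_radius_le T M hD ha.le hm.le hL hU₀ hm (mass_coercive_fullOpU T M ha.le (by positivity) m2 hU₀) hε0 hU hrad)

variable {ε : ℝ} (hε : 0 < ε) (hU : ∀ bd, ‖U bd - U₀ bd‖ ≤ ε) (h2a : 2 * ((L : ℝ) * ε) ≤ sliceRadius m2 a d) (hsmall : covLip m2 d * ((L : ℝ) * ε / sliceRadius m2 0 d) ≤ a⁻¹ / 2)
include hε hU h2a hsmall

/-- ★★★★ **THE BLOCK-FIELD GAUSSIAN NORMALISATION IS BOUNDED BELOW**: in the accretivity window, `((a⁻¹∕2)∕(a⁻¹ + 4e∕m²)²)^{|T_M|·n} ≤ |det Δ_eff(U,U⁻¹)|`.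
[cite: King1986, (2.14) p.653, (4.5) p.670; Balaban1985BackgroundPropagators, Thm 3.4 p.400] -/
theorem pow_le_norm_det_cxEffLap :
    ((a⁻¹ / 2) / (a⁻¹ + 4 / m2 * Real.exp 1) ^ 2) ^ Fintype.card (Tor M × n) ≤ ‖(cxEffLap T M a ((L : ℝ) ^ 2) m2 U (fun bd => (U bd)⁻¹)).det‖ :=
  pow_card_le_norm_det_of_eigen (by positivity) fun _ _ hv hΔv => norm_eigenvalue_cxEffLap_ge T M hD ha hm hL hU₀ hε hU h2a hsmall hv hΔv

omit hsmall in
/-- ★★★ **… AND ABOVE**: `|det Δ_eff(U,U⁻¹)| ≤ ((a + a²(8∕m²)e³)·K_{d+1}(ctRate(m²∕2,a,d)))^{|T_M|·n}`. [cite: King1986, (2.14) p.653, (4.34) p.674; Balaban1985BackgroundPropagators, Thm 3.4 p.400] -/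
theorem norm_det_cxEffLap_le_pow :
    ‖(cxEffLap T M a ((L : ℝ) ^ 2) m2 U (fun bd => (U bd)⁻¹)).det‖ ≤ ((a + a ^ 2 * (8 / m2 * Real.exp 3)) * B4Sect5Proof.latticeConst (d + 1) (ctRate (m2 / 2) a d)) ^ Fintype.card (Tor M × n) := by
  obtain ⟨_, hrad⟩ := windows_of_h2a (L := L) ha hm hε h2a
  exact (norm_det_le_l2_opNorm_pow M _).trans (pow_le_pow_left₀ (norm_nonneg _) (l2_opNorm_cxEffLap_at_massRadius_le T M hD ha hm hL hU₀ hε.le hU hrad) _)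

/-- ★★★ **THE NORMALISATION NEVER VANISHES IN THE WINDOW**: `det Δ_eff(U,U⁻¹) ≠ 0`. [cite: King1986, (2.14) p.653; Balaban1985BackgroundPropagators, Thm 3.4 p.400] -/
theorem det_cxEffLap_ne_zero : (cxEffLap T M a ((L : ℝ) ^ 2) m2 U (fun bd => (U bd)⁻¹)).det ≠ 0 := by
  have h := pow_le_norm_det_cxEffLap T M hD ha hm hL hU₀ hε hU h2a hsmall
  have hβ : 0 < ((a⁻¹ / 2) / (a⁻¹ + 4 / m2 * Real.exp 1) ^ 2) ^ Fintype.card (Tor M × n) := by positivity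
  intro h0
  rw [h0, norm_zero] at h
  linarith

/-- ★★★★ **THE FREE ENERGY PER DEGREE OF FREEDOM OF THE BLOCK-FIELD GAUSSIAN IS BOUNDED UNIFORMLY IN THE COMPLEX WINDOW**: with `β₁ = (a⁻¹∕2)∕(a⁻¹+4e∕m²)²`,
`Γ₁ = (a + a²(8∕m²)e³)K_{d+1}(ctRate(m²∕2,a,d))` and `N = |T_M|·n`:  `|log|det Δ_eff(U,U⁻¹)|| ≤ N·max(|log β₁|, |log Γ₁|)` — constants `(m²,a,d)` only, every unitary centre, every volume.
[cite: King1986, (2.14) p.653, (4.5) p.670, (4.45) p.675; Balaban1985BackgroundPropagators, Thm 3.4 p.400] -/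
theorem abs_log_norm_det_cxEffLap_le :
    |Real.log ‖(cxEffLap T M a ((L : ℝ) ^ 2) m2 U (fun bd => (U bd)⁻¹)).det‖|
      ≤ Fintype.card (Tor M × n) * max |Real.log ((a⁻¹ / 2) / (a⁻¹ + 4 / m2 * Real.exp 1) ^ 2)| |Real.log ((a + a ^ 2 * (8 / m2 * Real.exp 3)) * B4Sect5Proof.latticeConst (d + 1) (ctRate (m2 / 2) a d))| := by
  set β₁ : ℝ := (a⁻¹ / 2) / (a⁻¹ + 4 / m2 * Real.exp 1) ^ 2 with hβ₁
  set Γ₁ : ℝ := (a + a ^ 2 * (8 / m2 * Real.exp 3)) * B4Sect5Proof.latticeConst (d + 1) (ctRate (m2 / 2) a d) with hΓ₁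
  set N := Fintype.card (Tor M × n) with hN
  set D := ‖(cxEffLap T M a ((L : ℝ) ^ 2) m2 U (fun bd => (U bd)⁻¹)).det‖ with hDdef
  have hβpos : 0 < β₁ := by positivity
  have hlo : β₁ ^ N ≤ D := pow_le_norm_det_cxEffLap T M hD ha hm hL hU₀ hε hU h2a hsmall
  have hhi : D ≤ Γ₁ ^ N := norm_det_cxEffLap_le_pow T M hD ha hm hL hU₀ hε hU h2a
  have hβN : 0 < β₁ ^ N := pow_pos hβpos N
  have hDpos : 0 < D := lt_of_lt_of_le hβN hlo
  have h1 : (N : ℝ) * Real.log β₁ ≤ Real.log D := by rw [← Real.log_pow]; exact Real.log_le_log hβN hlo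
  have h2 : Real.log D ≤ (N : ℝ) * Real.log Γ₁ := by rw [← Real.log_pow]; exact Real.log_le_log hDpos hhi
  have hN0 : (0 : ℝ) ≤ N := Nat.cast_nonneg N
  have hm1 : |Real.log β₁| ≤ max |Real.log β₁| |Real.log Γ₁| := le_max_left _ _
  have hm2 : |Real.log Γ₁| ≤ max |Real.log β₁| |Real.log Γ₁| := le_max_right _ _
  rw [abs_le]
  constructor
  · have : -|Real.log β₁| ≤ Real.log β₁ := neg_abs_le _
    nlinarith
  · have : Real.log Γ₁ ≤ |Real.log Γ₁| := le_abs_self _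
    nlinarith

omit hε hU h2a hsmall in
/-- ★★★ **`U ↦ det Δ_eff(U,U⁻¹)` IS ANALYTIC ON THE POLYDISC** `‖U_b − U₀_b‖ < s₀(m²,a,d)∕L` (a finite sum over permutations of finite products of analytic entries). [cite: Balaban1985BackgroundPropagators, Thm 3.4 p.400; King1986, (2.14) p.653] -/
theorem analyticOnNhd_det_printEffLap_polydisc :
    AnalyticOnNhd ℂ (fun W : Tor (fine L M) × Fin (d + 1) → Matrix n n ℂ => (cxEffLap T M a ((L : ℝ) ^ 2) m2 W (fun bd => (W bd)⁻¹)).det) {U | ∀ bd, ‖U bd - U₀ bd‖ < sliceRadius m2 a d / L} := by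
  intro U hU
  have hΔ := analyticOnNhd_printEffLap_polydisc T M hD ha.le hm.le hL hU₀ hm (mass_coercive_fullOpU T M ha.le (by positivity) m2 hU₀) U hU
  have hentry : ∀ p q : Tor M × n, AnalyticAt ℂ (fun W : Tor (fine L M) × Fin (d + 1) → Matrix n n ℂ => cxEffLap T M a ((L : ℝ) ^ 2) m2 W (fun bd => (W bd)⁻¹) p q) U :=
    fun p q => ((cxEntryCLM M ℂ p q).analyticAt _).comp hΔ
  simp only [Matrix.det_apply']
  refine Finset.analyticAt_fun_sum _ fun σ _ => analyticAt_const.mul (Finset.analyticAt_fun_prod _ fun i _ => hentry (σ i) i)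

end Window

end Summit.QuantumFields.YangMills.BalabanUVNodes.N15KingModelRung.Analytic

end
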